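import Literature.Analysis.FluidPDE.ElgindiEllipticAssembly
import Literature.Analysis.FluidPDE.ElgindiEllipticHkTools
import Literature.Analysis.FluidPDE.ElgindiEllipticHkBoundA
import Literature.Analysis.FluidPDE.ElgindiEllipticHkBoundB
import Literature.Analysis.FluidPDE.ElgindiEllipticHkBoundC
import Literature.Analysis.FluidPDE.ElgindiEllipticHkBoundD
import HarnessLib

/-!
# The `𝓗⁴` elliptic a-priori estimate in the tree's norm — the theorem
([ElgindiGhoulMasmoudi2021] §6 Theorem 3 for `k = 4`; [Elgindi2021] §7.3–7.4)

Topic `Literature/Analysis/FluidPDE`. Proof file (everything proved, no definitions, no named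
facts) on the proof path of the named fact
`Literature.Analysis.FluidPDE.Elgindi.ElgindiGhoulMasmoudi2021_stabilityCore`
(`ElgindiStabilityDecomposition.lean`). T. M. Elgindi, T.-E. Ghoul, N. Masmoudi, Camb. J. Math. 9
(2021) = arXiv:1910.14071, §6 (p. 15 of the held text):

> "**Theorem 3.** Let `k ≥ 2`, `0 < α` sufficiently small and assume `F ∈ 𝓗ᵏ` satisfies the above
> orthogonality condition. Then the unique solution to (6.1) satisfies
> `α²|D_R²Ψ|_{𝓗ᵏ} + α|D_RΨ|_{𝓗ᵏ} + |∂_θθΨ|_{𝓗ᵏ} ≤ C_k|F|_{𝓗ᵏ}` for some `C_k > 0` depending on `k`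
> but independent of `α`."

This file assembles parts A–D into
`|∂_θθΨ|²_{𝓗⁴} + |αD_RΨ|²_{𝓗⁴} + |α²D_R²Ψ|²_{𝓗⁴} ≤ C·|L(Ψ)|²_{𝓗⁴}` (`elliptic_apriori_eHkNormSq`).
-/

noncomputable section

open MeasureTheory Set Real Filter Function Finset
open _root_.Topology
open scoped ENNReal

namespace Literature.Analysis.FluidPDE

namespace Elgindi

set_option linter.unusedSimpArgs false in
set_option linter.unusedTactic false in
set_option linter.unreachableTactic false in
set_option maxRecDepth 4000 in
set_option maxHeartbeats 8000000 in
/-- **The `𝓗⁴` elliptic a-priori estimate** (Theorem 3 of [ElgindiGhoulMasmoudi2021] for `k = 4`, in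
the a-priori class): for `0 < α ≤ 1/4`, `Ψ = cos θχ` with `χ ∈ C¹⁰(ℝ²)` compactly supported inside
`R > 0`, `χ(R,0) = 0`, and `F = L(Ψ)` orthogonal to `sin θcos²θ` on every slice,
`|∂_θθΨ|²_{𝓗⁴} + |αD_RΨ|²_{𝓗⁴} + |α²D_R²Ψ|²_{𝓗⁴} ≤ C·|F|²_{𝓗⁴}` with an absolute constant `C`.
[cite: ElgindiGhoulMasmoudi2021, §6 Theorem 3 (p. 15 of arXiv:1910.14071)]
[cite: Elgindi2021, §7.3 Proposition 7.7 and §7.4 Proposition 7.9 (p. 21–23 of arXiv:1904.04795)] -/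
theorem elliptic_apriori_eHkNormSq {α : ℝ} (hα : 0 < α) (hα4 : α ≤ 1 / 4) {χ : ℝ → ℝ → ℝ}
    (hχ : ContDiff ℝ 10 (uncurry χ)) (hs : HasCompactSupport (uncurry χ)) (hpos : ∀ p ∈ tsupport (uncurry χ), 0 < p.1)
    (hχ0 : ∀ R, χ R 0 = 0) {Ψ : ℝ → ℝ → ℝ} (hΨ : Ψ = fun R θ => Real.cos θ * χ R θ)
    (horth : ∀ R, 0 < R → ∫ θ in Ioo 0 (π / 2), ellipticOp α Ψ R θ * kernelK θ = 0) :
    eHkNormSq α 4 (dθ (dθ Ψ)) + eHkNormSq α 4 (α • Dz Ψ) + eHkNormSq α 4 ((α ^ 2) • (Dz^[2] Ψ)) ≤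
      ENNReal.ofReal (90 * 300000000000000000000000) * ((15 : ℝ≥0∞) * ENNReal.ofReal 689220) * eHkNormSq α 4 (ellipticOp α Ψ) := by
  obtain ⟨gF, hgF⟩ : ∃ gF : ℝ → ℝ → ℝ, gF = fun R θ => -α ^ 2 * R ^ 2 * dz (dz Ψ) R θ - α * (5 + α) * R * dz Ψ R θ -
      dθ (dθ Ψ) R θ + (Real.cos θ * χ R θ + Real.sin θ * dθ χ R θ) - 6 * Ψ R θ := ⟨_, rfl⟩
  obtain ⟨D, hD⟩ : ∃ D : ℝ, D = ((∫ p in strip, radialWeight p.1 ^ 2 * ellipticOp α Ψ p.1 p.2 ^ 2 * Real.sin (2 * p.2) ^ (-eta)) + (∫ p in strip, radialWeight p.1 ^ 2 * (Dz^[1] (ellipticOp α Ψ)) p.1 p.2 ^ 2 * Real.sin (2 * p.2) ^ (-eta)) + (∫ p in strip, radialWeight p.1 ^ 2 * (Dz^[2] (ellipticOp α Ψ)) p.1 p.2 ^ 2 * Real.sin (2 * p.2) ^ (-eta)) + (∫ p in strip, radialWeight p.1 ^ 2 * (Dz^[3] (ellipticOp α Ψ)) p.1 p.2 ^ 2 *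 Real.sin (2 * p.2) ^ (-eta)) + (∫ p in strip, radialWeight p.1 ^ 2 * (Dz^[4] (ellipticOp α Ψ)) p.1 p.2 ^ 2 * Real.sin (2 * p.2) ^ (-eta)) +
        (∫ p in strip, radialWeight p.1 ^ 2 * dθ gF p.1 p.2 ^ 2 * Real.sin (2 * p.2) ^ (2 - gammaExp α)) +
        (∫ p in strip, radialWeight p.1 ^ 2 * dθ (Dz^[1] gF) p.1 p.2 ^ 2 * Real.sin (2 * p.2) ^ (2 - gammaExp α)) +
        (∫ p in strip, radialWeight p.1 ^ 2 * dθ (Dz^[2] gF) p.1 p.2 ^ 2 * Real.sin (2 * p.2) ^ (2 - gammaExp α)) +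
        (∫ p in strip, radialWeight p.1 ^ 2 * dθ (Dz^[3] gF) p.1 p.2 ^ 2 * Real.sin (2 * p.2) ^ (2 - gammaExp α)) +
        (∫ p in strip, radialWeight p.1 ^ 2 * dθ (dθ gF) p.1 p.2 ^ 2 * Real.sin (2 * p.2) ^ (4 - gammaExp α)) +
        (∫ p in strip, radialWeight p.1 ^ 2 * dθ (dθ (Dz^[1] gF)) p.1 p.2 ^ 2 * Real.sin (2 * p.2) ^ (4 - gammaExp α)) +
        (∫ p in strip, radialWeight p.1 ^ 2 * dθ (dθ (Dz^[2] gF)) p.1 p.2 ^ 2 * Real.sin (2 * p.2) ^ (4 - gammaExp α)) +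
        (∫ p in strip, radialWeight p.1 ^ 2 * (dθ^[3] gF) p.1 p.2 ^ 2 * Real.sin (2 * p.2) ^ (6 - gammaExp α)) +
        (∫ p in strip, radialWeight p.1 ^ 2 * (dθ^[3] (Dz^[1] gF)) p.1 p.2 ^ 2 * Real.sin (2 * p.2) ^ (6 - gammaExp α)) +
        (∫ p in strip, radialWeight p.1 ^ 2 * (dθ^[4] gF) p.1 p.2 ^ 2 * Real.sin (2 * p.2) ^ (8 - gammaExp α))) := ⟨_, rfl⟩
  have EA := eHkNormSq_dθdθ_le hα hα4 hχ hs hpos hχ0 hΨ horth hgF hD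
  have EB := eHkNormSq_Dz_le hα hα4 hχ hs hpos hχ0 hΨ horth hgF hD
  have EC := eHkNormSq_DzDz_le hα hα4 hχ hs hpos hχ0 hΨ horth hgF hD
  have ED := ofReal_datum_le hα hα4 hχ hs hpos hχ0 hΨ horth hgF hD
  have hFeq : ∀ p ∈ strip, ellipticOp α Ψ p.1 p.2 = gF p.1 p.2 := ellipticOp_eq_smoothRep α hΨ hgF (hχ.of_le (by norm_num))
  have Enorm : eHkNormSq α 4 gF = eHkNormSq α 4 (ellipticOp α Ψ) := (eHkNormSq_congr_strip α 4 hFeq).symm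
  have hK0 : (0:ℝ) ≤ 300000000000000000000000 := by norm_num
  have hsum : eHkNormSq α 4 (dθ (dθ Ψ)) + eHkNormSq α 4 (α • Dz Ψ) + eHkNormSq α 4 ((α ^ 2) • (Dz^[2] Ψ)) ≤
      90 * ENNReal.ofReal (300000000000000000000000 * D) := by
    calc _ ≤ 30 * ENNReal.ofReal (300000000000000000000000 * D) + 30 * ENNReal.ofReal (300000000000000000000000 * D) + 30 * ENNReal.ofReal (300000000000000000000000 * D) :=
          add_le_add (add_le_add EA EB) EC
      _ = 90 * ENNReal.ofReal (300000000000000000000000 * D) := by ring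
  calc _ ≤ 90 * ENNReal.ofReal (300000000000000000000000 * D) := hsum
    _ = ENNReal.ofReal (90 * 300000000000000000000000) * ENNReal.ofReal D := by
        rw [ENNReal.ofReal_mul (by norm_num : (0:ℝ) ≤ 90), ENNReal.ofReal_mul hK0, ← mul_assoc]
        congr 1
        norm_num
    _ ≤ ENNReal.ofReal (90 * 300000000000000000000000) * ((15 : ℝ≥0∞) * (ENNReal.ofReal 689220 * eHkNormSq α 4 gF)) := mul_le_mul_right ED _
    _ = ENNReal.ofReal (90 * 300000000000000000000000) * ((15 : ℝ≥0∞) * ENNReal.ofReal 689220) * eHkNormSq α 4 (ellipticOp α Ψ) := by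
        rw [Enorm]; ring

end Elgindi

end Literature.Analysis.FluidPDE
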